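import Literature.AlgebraicGeometry.Frobenioids.EquivalenceTransportAnchors
import Literature.AlgebraicGeometry.Frobenioids.ElementaryFrobenioid
import HarnessLib

/-!
# Frobenioids I, §0: small facts on irreducible arrows, irreducible elements and prime degrees

Mochizuki, *The geometry of Frobenioids I: the general theory*, Kyushu J. Math. **62** (2008), §0
pp. 11–12 (sharp monoids, irreducible elements), p. 17 (irreducible arrows), Def. 1.1 (ii) p. 19
(pull-backs of a monoid on `D` are characteristically injective) [cite: MochizukiFrdI2008, §0 p.17].

PROOF-ONLY helper file (seat abc-iut-L1-t13): in a totally epimorphic category an irreducible arrow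
`b₁ ≫ b₂ ≫ b₃` has at most one non-invertible factor; a product of two (or, in a sharp monoid, of three
with two) non-trivial elements is not irreducible; powers and pull-backs of non-trivial elements are
non-trivial; irreducibility is invariant under pull-back along isomorphisms. Used by
`EquivalenceStepPrimeFrobenius.lean`. No statement of the paper is restated or strengthened.
-/

namespace Literature.AlgebraicGeometry.Frobenioids

open CategoryTheory Opposite

universe w v u

/-! ### Irreducible arrows: at most one non-invertible factor -/

section Irreducible

variable {C : Type u} [Category.{v} C]

/-- An irreducible arrow written as `f ≫ g` has `f` or `g` invertible (the defining property).
[cite: MochizukiFrdI2008, §0 p.17] -/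
theorem IsIrreducibleHom.isIso_or {X Y Z : C} {f : X ⟶ Y} {g : Y ⟶ Z}
    (h : IsIrreducibleHom (f ≫ g)) : IsIso f ∨ IsIso g :=
  (h.2 f g rfl).symm

/-- In a totally epimorphic category an irreducible arrow written as `b₁ ≫ b₂ ≫ b₃` has at most one
non-invertible factor. [cite: MochizukiFrdI2008, §0 p.17] -/
theorem IsIrreducibleHom.not_two_nonIso (hC : IsTotallyEpimorphic C) {X Y Z W : C} {b₁ : X ⟶ Y}
    {b₂ : Y ⟶ Z} {b₃ : Z ⟶ W} (h : IsIrreducibleHom (b₁ ≫ b₂ ≫ b₃)) (h₂ : ¬ IsIso b₂)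
    (h₃ : ¬ IsIso b₃) : False := by
  rcases h.isIso_or with h1 | h23
  · have h' : IsIrreducibleHom (b₂ ≫ b₃) :=
      h.of_arrow_iso (asIso b₁) (Iso.refl W) (by simp)
    rcases h'.isIso_or with h2 | h3
    · exact h₂ h2
    · exact h₃ h3
  · exact h₃ (hC.isIso_of_isIso_comp b₂ b₃).1

/-- Variant with the non-invertible factors in first and second position.
[cite: MochizukiFrdI2008, §0 p.17] -/
theorem IsIrreducibleHom.not_two_nonIso' (hC : IsTotallyEpimorphic C) {X Y Z W : C} {b₁ : X ⟶ Y}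
    {b₂ : Y ⟶ Z} {b₃ : Z ⟶ W} (h : IsIrreducibleHom (b₁ ≫ b₂ ≫ b₃)) (h₁ : ¬ IsIso b₁)
    (h₂ : ¬ IsIso b₂) : False := by
  rcases h.isIso_or with h1 | h23
  · exact h₁ h1
  · exact h₂ (hC.isIso_of_isIso_comp b₂ b₃).2

/-- Variant with the non-invertible factors in first and third position.
[cite: MochizukiFrdI2008, §0 p.17] -/
theorem IsIrreducibleHom.not_two_nonIso'' (hC : IsTotallyEpimorphic C) {X Y Z W : C} {b₁ : X ⟶ Y}
    {b₂ : Y ⟶ Z} {b₃ : Z ⟶ W} (h : IsIrreducibleHom (b₁ ≫ b₂ ≫ b₃)) (h₁ : ¬ IsIso b₁)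
    (h₃ : ¬ IsIso b₃) : False := by
  rcases h.isIso_or with h1 | h23
  · exact h₁ h1
  · exact h₃ (hC.isIso_of_isIso_comp b₂ b₃).1

end Irreducible

/-! ### Monoid bookkeeping: irreducible elements and pull-backs -/

section Monoid

variable {D : Type u} [Category.{v} D] (Φ : Dᵒᵖ ⥤ CommMonCat.{w})

/-- A product of two non-trivial elements is not irreducible. [cite: MochizukiFrdI2008, §0 p.12] -/
theorem not_isIrreducibleElt_mul {M : Type w} [CommMonoid M] {a b : M} (ha : a ≠ 1) (hb : b ≠ 1) :
    ¬ IsIrreducibleElt (a * b) := fun h => by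
  rcases h.2 a b rfl with h1 | h1
  · exact ha h1
  · exact hb h1

/-- In a sharp monoid a product of three elements of which two are non-trivial is not irreducible.
[cite: MochizukiFrdI2008, §0 p.12] -/
theorem not_isIrreducibleElt_mul₃ {M : Type w} [CommMonoid M] (hS : IsSharp M) {a b c : M}
    (h : (a ≠ 1 ∧ b ≠ 1) ∨ (a ≠ 1 ∧ c ≠ 1) ∨ (b ≠ 1 ∧ c ≠ 1)) : ¬ IsIrreducibleElt (a * b * c) := by
  intro hirr
  have h1 := hirr.2 a (b * c) (mul_assoc a b c)
  have h2 := hirr.2 (a * b) c rfl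
  have hu : ∀ {x y : M}, x * y = 1 → x = 1 ∧ y = 1 := fun {x y} hxy =>
    ⟨hS.eq_one_of_isUnit x (IsUnit.of_mul_eq_one y hxy),
      hS.eq_one_of_isUnit y (IsUnit.of_mul_eq_one_right x hxy)⟩
  rcases h with ⟨ha, hb⟩ | ⟨ha, hc⟩ | ⟨hb, hc⟩
  · rcases h1 with h | h
    · exact ha h
    · exact hb (hu h).1
  · rcases h1 with h | h
    · exact ha h
    · exact hc (hu h).2
  · rcases h2 with h | h
    · exact hb (hu h).2
    · exact hc h

/-- In a sharp monoid a power of a non-trivial element is non-trivial. [cite: MochizukiFrdI2008, §0 p.11] -/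
theorem pow_ne_one_of_ne_one {M : Type w} [CommMonoid M] (hS : IsSharp M) {a : M} (ha : a ≠ 1)
    {n : ℕ} (hn : n ≠ 0) : a ^ n ≠ 1 := fun h =>
  ha (hS.eq_one_of_isUnit a (IsUnit.of_pow_eq_one h hn))

/-- Pull-backs of a monoid on `D` are injective (Def. 1.1 (ii)(a)), so they detect `1`.
[cite: MochizukiFrdI2008, Def. 1.1 (ii) p.19] -/
theorem pull_ne_one (hΦ : IsMonoidOn Φ) {X Y : D} (f : Y ⟶ X) {x : Φ.obj (op X)} (hx : x ≠ 1) :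
    pull Φ f x ≠ 1 := fun h => hx ((hΦ.isCharInjective f).1 (h.trans (map_one _).symm))

/-- Irreducibility is invariant under pull-back along an isomorphism of `D`.
[cite: MochizukiFrdI2008, §0 p.12] -/
theorem isIrreducibleElt_pull_iff {X Y : D} (f : Y ⟶ X) [IsIso f] (x : Φ.obj (op X)) :
    IsIrreducibleElt (pull Φ f x) ↔ IsIrreducibleElt x := by
  have hl : ∀ z : Φ.obj (op X), pull Φ (inv f) (pull Φ f z) = z := fun z => by
    rw [← pull_comp, IsIso.inv_hom_id, pull_id]
  have hr : ∀ z : Φ.obj (op Y), pull Φ f (pull Φ (inv f) z) = z := fun z => by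
    rw [← pull_comp, IsIso.hom_inv_id, pull_id]
  constructor
  · rintro ⟨h1, h2⟩
    refine ⟨fun hx => h1 (by rw [hx, map_one]), fun b c hbc => ?_⟩
    rcases h2 (pull Φ f b) (pull Φ f c) (by rw [hbc, map_mul]) with h | h
    · exact Or.inl (by simpa [hl] using congrArg (pull Φ (inv f)) h)
    · exact Or.inr (by simpa [hl] using congrArg (pull Φ (inv f)) h)
  · rintro ⟨h1, h2⟩
    refine ⟨fun hx => h1 (by simpa [hl] using congrArg (pull Φ (inv f)) hx), fun b c hbc => ?_⟩
    rcases h2 (pull Φ (inv f) b) (pull Φ (inv f) c)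
        (by simpa [hl] using congrArg (pull Φ (inv f)) hbc) with h | h
    · exact Or.inl (by simpa [hr] using congrArg (pull Φ f) h)
    · exact Or.inr (by simpa [hr] using congrArg (pull Φ f) h)

end Monoid

end Literature.AlgebraicGeometry.Frobenioids
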